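import Summits.BirchSwinnertonDyer.BirchSwinnertonDyer.Theorems.KolyvaginDepthDoorDepthTableSteinWuthrichRankThree5077a1Exact
import Summits.BirchSwinnertonDyer.BirchSwinnertonDyer.Theorems.KolyvaginDepthDoorDepthTableSteinWuthrichRankThree11197a1
import Summits.BirchSwinnertonDyer.BirchSwinnertonDyer.Theorems.KolyvaginDepthDoorDepthTableSteinWuthrichRankThree16811a1
import Summits.BirchSwinnertonDyer.BirchSwinnertonDyer.Theorems.KolyvaginDepthDoorDepthTableSteinWuthrichRankThree18097b1
import Summits.BirchSwinnertonDyer.BirchSwinnertonDyer.Theorems.KolyvaginDepthDoorDepthTableIntrinsicOddRank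
import HarnessLib

/-!
# Route `KolyvaginDepthDoor`, crux `KolyvaginDepthSupplyKN` (stmt-BirchSwinnertonDyer-22820) —
# DEPTH TABLE v16: the ODD-RANK rows `5077a1`, `11197a1`, `16811a1`, `18097b1` INTRINSIC (in `L`-value currency), UNIFORM IN THE HEEGNER FIELD `K` AND IN THE PRIME `p`

Helper file of the lead prover of line `levelone` (kdd-p1 g20; `--supports stmt-BirchSwinnertonDyer-22820
--as helper`); it closes nothing and BSD is NOT proved by it.

g18 read the rank-three rows at `p = 5` (`7` for `18745a1`) and the Heegner field of record through a kernel-certified minimal model of the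
rank-ZERO twist (`…RankThree<label>TwistLValue`). v16 (`cruxBody_of_twistLValue_intrinsic_spade`) removes the field of record and every
hypothesis on the twist model: for each curve below, for EVERY admissible `5 ≤ p < 1000` (good ordinary, `ρ_{E,p^n}` onto — hypotheses;
Kodaira–Néron / ♠ at every `p ≥ 5` are proved here from `Δ_min`), EVERY imaginary quadratic `K` (`d_K ∉ {−3,−4}`, `p ∤ d_K`, Heegner — any
parity of `d_K`) and ANY globally minimal model `T` of `E^{(d_K)}` — whose irreducibility, good ordinary reduction and Skinner's (ram) (at
the curve's multiplicative prime, split in `K`) are DERIVED —: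

  «`L(E^{(d_K)}, 1) ≠ 0` ∧ `ord_p(L(T,1)/Ω_T) ≤ 3`»  ⟹  the clause of `KolyvaginDepthSupplyKN` at the curve VERBATIM.

CONDITIONAL on Stein–Wuthrich 2013 Thm. 1.1, W. Zhang 2014 L8.4 (1) / 9.1, Skinner 2016 Thm. C, GZK, BY NAME; per curve; nothing class-wide
(the open stub (S♭) is untouched); BSD is NOT proved by any of this.

References: [SteinWuthrich2013] Thm. 1.1; [WZhang2014] L8.4 (1), Thm. 9.1, Hypothesis ♠; [Skinner2016PacificMC] Thm. C; [Darmon2004] Thm. 3.22;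
[SilvermanAEC2009] VII.5.1, VIII.8, X.4.2; [CremonaAlgorithms1997] Table 1.
-/

set_option linter.dupNamespace false

noncomputable section

open scoped Classical NumberField

namespace Summit.BirchSwinnertonDyer.BirchSwinnertonDyer.Theorems.KolyvaginDepthDoor

open Literature.NumberTheory.EllipticCurves Literature.NumberTheory.EllipticCurves.ModularForms
  WeierstrassCurve NumberField IsDedekindDomain
open Summit.BirchSwinnertonDyer.BirchSwinnertonDyer.Theorems
open Summit.BirchSwinnertonDyer.BirchSwinnertonDyer.Rank2Observatory
open Summit.BirchSwinnertonDyer.BirchSwinnertonDyer.Rank1Residual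
open Summit.BirchSwinnertonDyer.Rank1Residual.Additive

namespace C5077a1

/-- **THE CRUX `KolyvaginDepthSupplyKN` AT THE RANK-THREE CURVE `5077a1` — INTRINSIC ROW IN `L`-VALUE CURRENCY, UNIFORM IN THE HEEGNER FIELD AND
IN THE PRIME (depth table v16).** For EVERY admissible `5 ≤ p < 1000` (good ordinary, `ρ_{E,p^n}` onto — hypotheses; Kodaira–Néron and ♠ hold
at every `p ≥ 5`), EVERY imaginary quadratic `K` with `d_K ∉ {−3,−4}`, `p ∤ d_K` and the Heegner hypothesis for `N = 5077`, and ANY globally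
minimal model `T` of the twist `E^{(d_K)}` (no arithmetic hypothesis on `T`: its irreducibility, good ordinary reduction and Skinner's (ram)
— at the multiplicative prime `5077` of `E`, which splits in `K` — are derived): IF `L(E^{(d_K)}, 1) ≠ 0` and `ord_p(L(T,1)/Ω_T) ≤ 3`, THEN the
clause of `KolyvaginDepthSupplyKN` holds at `W = 5077a1` VERBATIM (generic `cruxBody_of_twistLValue_intrinsic_spade`, tolerance `k = 3 ≤ rank`).
CONDITIONAL on Stein–Wuthrich Thm. 1.1, W. Zhang L8.4 (1) / 9.1, Skinner 2016 Thm. C, GZK by name; per curve; nothing class-wide; BSD is not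
proved by it. [cite: SteinWuthrich2013, Thm. 1.1 (p. 1758)] [cite: WZhang2014, Lemma 8.4 (1) (p. 236), Thm. 9.1 (p. 240)]
[cite: Skinner2016PacificMC, Thm. C (p. 173)] [cite: CremonaAlgorithms1997, Table 1 (5077a1)] -/
theorem cruxBody_LValue_intrinsic_at
    (hSW : SteinWuthrich2013_sha_inf_torsionBy_eq_bot_of_two_le_rank)
    (h84 : Literature.NumberTheory.EllipticCurves.WZhang2014_lemma84_exists_minimal_kolyvaginClass_one_selmerCard)
    (hSk : Skinner2016_padicValRat_bsd_rank_zero) (hGZK : rank_eq_analyticRank_of_analyticRank_le_one)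
    (p : ℕ) [hp : Fact p.Prime] (h5 : 5 ≤ p) (hp1000 : p < 1000)
    (hgood : haveI := isElliptic_of_mem_atlasR3A00 mem_atlas; haveI := isGloballyMinimal_of_mem_atlasR3A00 mem_atlas; (c5077a1.e.baseChange ℚ).HasGoodReductionAtPrime p)
    (hord : haveI := isElliptic_of_mem_atlasR3A00 mem_atlas; haveI := isGloballyMinimal_of_mem_atlasR3A00 mem_atlas; ¬ (p : ℤ) ∣ (c5077a1.e.baseChange ℚ).frobeniusTrace p)
    (htower : ∀ n : ℕ, (c5077a1.e.baseChange ℚ).HasSurjectiveModNGaloisRep (p ^ n : ℕ))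
    (K : Type) [Field K] [NumberField K] (hK : IsImaginaryQuadratic K)
    (hD3 : NumberField.discr K ≠ -3) (hD4 : NumberField.discr K ≠ -4) (hpD : ¬ ((p : ℤ) ∣ NumberField.discr K))
    (hH : SatisfiesHeegnerHypothesis 5077 K)
    (T : WeierstrassCurve ℚ) [T.IsElliptic] [T.IsGloballyMinimal] (C : WeierstrassCurve.VariableChange ℚ)
    (hC : C • T = (c5077a1.e.baseChange ℚ).quadraticTwist (NumberField.discr K : ℚ))
    (hL : ((c5077a1.e.baseChange ℚ).quadraticTwist (NumberField.discr K : ℚ)).entireLFunction 1 ≠ 0)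
    (hval : ∀ q : ℚ, T.entireLFunction 1 / ((T.realPeriodRat : ℝ) : ℂ) = (q : ℂ) → padicValRat p q ≤ 3) :
    haveI := isElliptic_of_mem_atlasR3A00 mem_atlas; haveI := isGloballyMinimal_of_mem_atlasR3A00 mem_atlas;
    ∃ (p : ℕ) (hp : Fact p.Prime), 5 ≤ p ∧ (c5077a1.e.baseChange ℚ).HasGoodReductionAtPrime p ∧
      ¬ (p : ℤ) ∣ (c5077a1.e.baseChange ℚ).frobeniusTrace p ∧ (∀ n : ℕ, (c5077a1.e.baseChange ℚ).HasSurjectiveModNGaloisRep (p ^ n : ℕ)) ∧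
      (∀ v : HeightOneSpectrum (𝓞 ℚ), (c5077a1.e.baseChange ℚ).HasMultiplicativeReductionAt v →
        ¬ p ∣ (c5077a1.e.baseChange ℚ).ordMinimalDiscriminant v) ∧
      ∃ (K : Type) (_ : Field K) (_ : NumberField K), IsImaginaryQuadratic K ∧
        NumberField.discr K ≠ -3 ∧ NumberField.discr K ≠ -4 ∧
        ∃ (_ : NeZero ((c5077a1.e.baseChange ℚ).conductorNorm ℤ)), SatisfiesHeegnerHypothesis ((c5077a1.e.baseChange ℚ).conductorNorm ℤ) K ∧
        ∃ (Dt : ModularParametrizationData (c5077a1.e.baseChange ℚ) ((c5077a1.e.baseChange ℚ).conductorNorm ℤ)) (β : ℤ) (ι : K →+* ℂ) (n₁ : ℕ)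
          (d : KolyvaginHeegnerData Dt β ι n₁), Squarefree n₁ ∧
          (∀ q ∈ n₁.primeFactors, Zhang2014.IsKolyvaginPrime ((c5077a1.e.baseChange ℚ).conductorNorm ℤ) (c5077a1.e.baseChange ℚ) K p q) ∧
          d.kolyvaginClass hp.out 1 ≠ 0 ∧
          (n₁.primeFactors.card + 1 ≤ (c5077a1.e.baseChange ℚ).mordellWeilRank ∨
            (n₁.primeFactors.card ≤ (c5077a1.e.baseChange ℚ).mordellWeilRank ∧
              n₁.primeFactors.card + 1 ≤ ((c5077a1.e.baseChange ℚ).quadraticTwist (NumberField.discr K : ℚ)).mordellWeilRank)) := by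
  haveI := isElliptic_of_mem_atlasR3A00 mem_atlas; haveI := isGloballyMinimal_of_mem_atlasR3A00 mem_atlas
  haveI iNZ : NeZero ((c5077a1.e.baseChange ℚ).conductorNorm ℤ) := neZero_conductorNorm_of_isElliptic _
  have hsp := spadeOne_of_prime p
  have hHN : SatisfiesHeegnerHypothesis ((c5077a1.e.baseChange ℚ).conductorNorm ℤ) K := by rw [conductorNorm_eq]; exact hH
  have hS2 : ¬ Squarefree ((c5077a1.e.baseChange ℚ).conductorNorm ℤ) →
      (∃ (ℓ : ℕ) (_ : Fact ℓ.Prime), (c5077a1.e.baseChange ℚ).HasMultiplicativeReductionAtPrime ℓ ∧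
          ¬ p ∣ padicValInt ℓ (c5077a1.e.baseChange ℚ).minimalDiscriminantInt) ∧
        ∃ (ℓ₁ ℓ₂ : ℕ) (_ : Fact ℓ₁.Prime) (_ : Fact ℓ₂.Prime), ℓ₁ ≠ ℓ₂ ∧
          (c5077a1.e.baseChange ℚ).HasMultiplicativeReductionAtPrime ℓ₁ ∧ (c5077a1.e.baseChange ℚ).HasMultiplicativeReductionAtPrime ℓ₂ :=
    fun hns ↦ absurd ((c5077a1.e.baseChange ℚ).isSemistable_iff_squarefree_conductorNorm.mp hsp.2) hns
  have hmult : ∃ ℓ : ℕ, ∃ _ : Fact ℓ.Prime, (c5077a1.e.baseChange ℚ).HasMultiplicativeReductionAtPrime ℓ :=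
    ⟨5077, Fact.mk (by norm_num), by
      haveI := Fact.mk (by norm_num : Nat.Prime 5077)
      exact IntModel.hasMultiplicativeReductionAtPrime_of_intModel intModel 5077 (by decide +kernel) (by decide +kernel)⟩
  exact cruxBody_of_twistLValue_intrinsic_spade hSW h84 hSk hGZK _ not_hasCM (le_trans (by norm_num) three_le_rank)
    (by rw [conductorNorm_eq]; norm_num) hmult p h5 hp1000 hgood hord htower (kodairaNeron_of_five_le p h5) hsp.1 hS2 K hK hD3 hD4
    hpD hHN T C hC hL 3 three_le_rank hval

end C5077a1

namespace C11197a1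

/-- **Kodaira–Néron for `11197a1` at every `p ≥ 5`**: `|Δ_min| = 11197 = 11197`, every exponent `< 5`.
[cite: CremonaAlgorithms1997, Table 1 (11197a1)] [cite: SilvermanAEC2009, VII.5.1, VIII.8] -/
theorem kodairaNeron_of_five_le (p : ℕ) (h5 : 5 ≤ p) :
    haveI := isElliptic_of_mem_atlasR3A00 mem_atlas; haveI := isGloballyMinimal_of_mem_atlasR3A00 mem_atlas;
    ∀ v : HeightOneSpectrum (𝓞 ℚ), (c11197a1.e.baseChange ℚ).HasMultiplicativeReductionAt v →
      ¬ p ∣ (c11197a1.e.baseChange ℚ).ordMinimalDiscriminant v := by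
  haveI := isElliptic_of_mem_atlasR3A00 mem_atlas; haveI := isGloballyMinimal_of_mem_atlasR3A00 mem_atlas
  refine not_dvd_ordMinimalDiscriminant_of_intModel_table intModel (p := p) (Δ₀ := 11197) (by decide +kernel)
    (B := 7) (lt_of_lt_of_le (by norm_num) (Nat.pow_le_pow_right (by norm_num) h5)) ?_
  intro q hq hqP hqd
  have hn : ((11197 : ℤ).natAbs) = 11197 ^ 1 := by norm_num
  rw [hn] at hqd ⊢
  obtain rfl := (Nat.prime_dvd_prime_iff_eq hqP (by norm_num)).mp (hqP.dvd_of_dvd_pow hqd)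
  exact absurd (Finset.mem_range.mp hq) (by norm_num)

/-- **♠ (1) for `11197a1` at every prime `p ≥ 5`** (`|Δ_min| = 11197`, exponents `< 5`) **and semistability** (`gcd(c₄, Δ) = 1`).
[cite: WZhang2014, Hypothesis ♠ (pp. 194–195)] [cite: CremonaAlgorithms1997, Table 1 (11197a1)] -/
theorem spadeOne_of_five_le (p : ℕ) [hp : Fact p.Prime] (h5 : 5 ≤ p) :
    haveI := isElliptic_of_mem_atlasR3A00 mem_atlas; haveI := isGloballyMinimal_of_mem_atlasR3A00 mem_atlas;
    (∀ (ℓ : ℕ) [Fact ℓ.Prime], (c11197a1.e.baseChange ℚ).HasMultiplicativeReductionAtPrime ℓ →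
      ¬ p ∣ padicValInt ℓ (c11197a1.e.baseChange ℚ).minimalDiscriminantInt) ∧
      (c11197a1.e.baseChange ℚ).IsSemistable ℤ := by
  haveI := isElliptic_of_mem_atlasR3A00 mem_atlas; haveI := isGloballyMinimal_of_mem_atlasR3A00 mem_atlas
  refine ⟨not_dvd_padicValInt_of_intModel intModel p ?_,
    isSemistable_int_of_intModel_of_isCoprime intModel (by rw [Int.isCoprime_iff_gcd_eq_one]; decide +kernel)⟩
  intro q hqP hqd
  have hΔ : (⟨1, -1, 1, -6, 0⟩ : WeierstrassCurve ℤ).Δ = 11197 := by decide +kernel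
  rw [hΔ] at hqd ⊢
  have hqd' : q ∣ (11197 : ℤ).natAbs := Int.natCast_dvd.mp hqd
  have hn : ((11197 : ℤ).natAbs) = 11197 ^ 1 := by norm_num
  rw [hn] at hqd'
  obtain rfl := (Nat.prime_dvd_prime_iff_eq hqP (by norm_num)).mp (hqP.dvd_of_dvd_pow hqd')
  exact ⟨1, by decide +kernel, by decide +kernel, Nat.not_dvd_of_pos_of_lt (by norm_num) (by omega)⟩

/-- **THE CRUX `KolyvaginDepthSupplyKN` AT THE RANK-THREE CURVE `11197a1` — INTRINSIC ROW IN `L`-VALUE CURRENCY, UNIFORM IN THE HEEGNER FIELD AND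
IN THE PRIME (depth table v16).** For EVERY admissible `5 ≤ p < 1000` (good ordinary, `ρ_{E,p^n}` onto — hypotheses; Kodaira–Néron and ♠ hold
at every `p ≥ 5`), EVERY imaginary quadratic `K` with `d_K ∉ {−3,−4}`, `p ∤ d_K` and the Heegner hypothesis for `N = 11197`, and ANY globally
minimal model `T` of the twist `E^{(d_K)}` (no arithmetic hypothesis on `T`: its irreducibility, good ordinary reduction and Skinner's (ram)
— at the multiplicative prime `11197` of `E`, which splits in `K` — are derived): IF `L(E^{(d_K)}, 1) ≠ 0` and `ord_p(L(T,1)/Ω_T) ≤ 3`, THEN the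
clause of `KolyvaginDepthSupplyKN` holds at `W = 11197a1` VERBATIM (generic `cruxBody_of_twistLValue_intrinsic_spade`, tolerance `k = 3 ≤ rank`).
CONDITIONAL on Stein–Wuthrich Thm. 1.1, W. Zhang L8.4 (1) / 9.1, Skinner 2016 Thm. C, GZK by name; per curve; nothing class-wide; BSD is not
proved by it. [cite: SteinWuthrich2013, Thm. 1.1 (p. 1758)] [cite: WZhang2014, Lemma 8.4 (1) (p. 236), Thm. 9.1 (p. 240)]
[cite: Skinner2016PacificMC, Thm. C (p. 173)] [cite: CremonaAlgorithms1997, Table 1 (11197a1)] -/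
theorem cruxBody_LValue_intrinsic_at
    (hSW : SteinWuthrich2013_sha_inf_torsionBy_eq_bot_of_two_le_rank)
    (h84 : Literature.NumberTheory.EllipticCurves.WZhang2014_lemma84_exists_minimal_kolyvaginClass_one_selmerCard)
    (hSk : Skinner2016_padicValRat_bsd_rank_zero) (hGZK : rank_eq_analyticRank_of_analyticRank_le_one)
    (p : ℕ) [hp : Fact p.Prime] (h5 : 5 ≤ p) (hp1000 : p < 1000)
    (hgood : haveI := isElliptic_of_mem_atlasR3A00 mem_atlas; haveI := isGloballyMinimal_of_mem_atlasR3A00 mem_atlas; (c11197a1.e.baseChange ℚ).HasGoodReductionAtPrime p)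
    (hord : haveI := isElliptic_of_mem_atlasR3A00 mem_atlas; haveI := isGloballyMinimal_of_mem_atlasR3A00 mem_atlas; ¬ (p : ℤ) ∣ (c11197a1.e.baseChange ℚ).frobeniusTrace p)
    (htower : ∀ n : ℕ, (c11197a1.e.baseChange ℚ).HasSurjectiveModNGaloisRep (p ^ n : ℕ))
    (K : Type) [Field K] [NumberField K] (hK : IsImaginaryQuadratic K)
    (hD3 : NumberField.discr K ≠ -3) (hD4 : NumberField.discr K ≠ -4) (hpD : ¬ ((p : ℤ) ∣ NumberField.discr K))
    (hH : SatisfiesHeegnerHypothesis 11197 K)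
    (T : WeierstrassCurve ℚ) [T.IsElliptic] [T.IsGloballyMinimal] (C : WeierstrassCurve.VariableChange ℚ)
    (hC : C • T = (c11197a1.e.baseChange ℚ).quadraticTwist (NumberField.discr K : ℚ))
    (hL : ((c11197a1.e.baseChange ℚ).quadraticTwist (NumberField.discr K : ℚ)).entireLFunction 1 ≠ 0)
    (hval : ∀ q : ℚ, T.entireLFunction 1 / ((T.realPeriodRat : ℝ) : ℂ) = (q : ℂ) → padicValRat p q ≤ 3) :
    haveI := isElliptic_of_mem_atlasR3A00 mem_atlas; haveI := isGloballyMinimal_of_mem_atlasR3A00 mem_atlas;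
    ∃ (p : ℕ) (hp : Fact p.Prime), 5 ≤ p ∧ (c11197a1.e.baseChange ℚ).HasGoodReductionAtPrime p ∧
      ¬ (p : ℤ) ∣ (c11197a1.e.baseChange ℚ).frobeniusTrace p ∧ (∀ n : ℕ, (c11197a1.e.baseChange ℚ).HasSurjectiveModNGaloisRep (p ^ n : ℕ)) ∧
      (∀ v : HeightOneSpectrum (𝓞 ℚ), (c11197a1.e.baseChange ℚ).HasMultiplicativeReductionAt v →
        ¬ p ∣ (c11197a1.e.baseChange ℚ).ordMinimalDiscriminant v) ∧
      ∃ (K : Type) (_ : Field K) (_ : NumberField K), IsImaginaryQuadratic K ∧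
        NumberField.discr K ≠ -3 ∧ NumberField.discr K ≠ -4 ∧
        ∃ (_ : NeZero ((c11197a1.e.baseChange ℚ).conductorNorm ℤ)), SatisfiesHeegnerHypothesis ((c11197a1.e.baseChange ℚ).conductorNorm ℤ) K ∧
        ∃ (Dt : ModularParametrizationData (c11197a1.e.baseChange ℚ) ((c11197a1.e.baseChange ℚ).conductorNorm ℤ)) (β : ℤ) (ι : K →+* ℂ) (n₁ : ℕ)
          (d : KolyvaginHeegnerData Dt β ι n₁), Squarefree n₁ ∧
          (∀ q ∈ n₁.primeFactors, Zhang2014.IsKolyvaginPrime ((c11197a1.e.baseChange ℚ).conductorNorm ℤ) (c11197a1.e.baseChange ℚ) K p q) ∧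
          d.kolyvaginClass hp.out 1 ≠ 0 ∧
          (n₁.primeFactors.card + 1 ≤ (c11197a1.e.baseChange ℚ).mordellWeilRank ∨
            (n₁.primeFactors.card ≤ (c11197a1.e.baseChange ℚ).mordellWeilRank ∧
              n₁.primeFactors.card + 1 ≤ ((c11197a1.e.baseChange ℚ).quadraticTwist (NumberField.discr K : ℚ)).mordellWeilRank)) := by
  haveI := isElliptic_of_mem_atlasR3A00 mem_atlas; haveI := isGloballyMinimal_of_mem_atlasR3A00 mem_atlas
  haveI iNZ : NeZero ((c11197a1.e.baseChange ℚ).conductorNorm ℤ) := neZero_conductorNorm_of_isElliptic _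
  have hsp := spadeOne_of_five_le p h5
  have hHN : SatisfiesHeegnerHypothesis ((c11197a1.e.baseChange ℚ).conductorNorm ℤ) K := by rw [conductorNorm_eq]; exact hH
  have hS2 : ¬ Squarefree ((c11197a1.e.baseChange ℚ).conductorNorm ℤ) →
      (∃ (ℓ : ℕ) (_ : Fact ℓ.Prime), (c11197a1.e.baseChange ℚ).HasMultiplicativeReductionAtPrime ℓ ∧
          ¬ p ∣ padicValInt ℓ (c11197a1.e.baseChange ℚ).minimalDiscriminantInt) ∧
        ∃ (ℓ₁ ℓ₂ : ℕ) (_ : Fact ℓ₁.Prime) (_ : Fact ℓ₂.Prime), ℓ₁ ≠ ℓ₂ ∧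
          (c11197a1.e.baseChange ℚ).HasMultiplicativeReductionAtPrime ℓ₁ ∧ (c11197a1.e.baseChange ℚ).HasMultiplicativeReductionAtPrime ℓ₂ :=
    fun hns ↦ absurd ((c11197a1.e.baseChange ℚ).isSemistable_iff_squarefree_conductorNorm.mp hsp.2) hns
  have hmult : ∃ ℓ : ℕ, ∃ _ : Fact ℓ.Prime, (c11197a1.e.baseChange ℚ).HasMultiplicativeReductionAtPrime ℓ :=
    ⟨11197, Fact.mk (by norm_num), by
      haveI := Fact.mk (by norm_num : Nat.Prime 11197)
      exact IntModel.hasMultiplicativeReductionAtPrime_of_intModel intModel 11197 (by decide +kernel) (by decide +kernel)⟩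
  exact cruxBody_of_twistLValue_intrinsic_spade hSW h84 hSk hGZK _ not_hasCM (le_trans (by norm_num) three_le_rank)
    (by rw [conductorNorm_eq]; norm_num) hmult p h5 hp1000 hgood hord htower (kodairaNeron_of_five_le p h5) hsp.1 hS2 K hK hD3 hD4
    hpD hHN T C hC hL 3 three_le_rank hval

end C11197a1

namespace C16811a1

/-- **Kodaira–Néron for `16811a1` at every `p ≥ 5`**: `|Δ_min| = 16811 = 16811`, every exponent `< 5`.
[cite: CremonaAlgorithms1997, Table 1 (16811a1)] [cite: SilvermanAEC2009, VII.5.1, VIII.8] -/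
theorem kodairaNeron_of_five_le (p : ℕ) (h5 : 5 ≤ p) :
    haveI := isElliptic_of_mem_atlasR3A00 mem_atlas; haveI := isGloballyMinimal_of_mem_atlasR3A00 mem_atlas;
    ∀ v : HeightOneSpectrum (𝓞 ℚ), (c16811a1.e.baseChange ℚ).HasMultiplicativeReductionAt v →
      ¬ p ∣ (c16811a1.e.baseChange ℚ).ordMinimalDiscriminant v := by
  haveI := isElliptic_of_mem_atlasR3A00 mem_atlas; haveI := isGloballyMinimal_of_mem_atlasR3A00 mem_atlas
  refine not_dvd_ordMinimalDiscriminant_of_intModel_table intModel (p := p) (Δ₀ := -16811) (by decide +kernel)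
    (B := 8) (lt_of_lt_of_le (by norm_num) (Nat.pow_le_pow_right (by norm_num) h5)) ?_
  intro q hq hqP hqd
  have hn : ((-16811 : ℤ).natAbs) = 16811 ^ 1 := by norm_num
  rw [hn] at hqd ⊢
  obtain rfl := (Nat.prime_dvd_prime_iff_eq hqP (by norm_num)).mp (hqP.dvd_of_dvd_pow hqd)
  exact absurd (Finset.mem_range.mp hq) (by norm_num)

/-- **♠ (1) for `16811a1` at every prime `p ≥ 5`** (`|Δ_min| = 16811`, exponents `< 5`) **and semistability** (`gcd(c₄, Δ) = 1`).
[cite: WZhang2014, Hypothesis ♠ (pp. 194–195)] [cite: CremonaAlgorithms1997, Table 1 (16811a1)] -/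
theorem spadeOne_of_five_le (p : ℕ) [hp : Fact p.Prime] (h5 : 5 ≤ p) :
    haveI := isElliptic_of_mem_atlasR3A00 mem_atlas; haveI := isGloballyMinimal_of_mem_atlasR3A00 mem_atlas;
    (∀ (ℓ : ℕ) [Fact ℓ.Prime], (c16811a1.e.baseChange ℚ).HasMultiplicativeReductionAtPrime ℓ →
      ¬ p ∣ padicValInt ℓ (c16811a1.e.baseChange ℚ).minimalDiscriminantInt) ∧
      (c16811a1.e.baseChange ℚ).IsSemistable ℤ := by
  haveI := isElliptic_of_mem_atlasR3A00 mem_atlas; haveI := isGloballyMinimal_of_mem_atlasR3A00 mem_atlas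
  refine ⟨not_dvd_padicValInt_of_intModel intModel p ?_,
    isSemistable_int_of_intModel_of_isCoprime intModel (by rw [Int.isCoprime_iff_gcd_eq_one]; decide +kernel)⟩
  intro q hqP hqd
  have hΔ : (⟨0, 0, 1, -1, 6⟩ : WeierstrassCurve ℤ).Δ = -16811 := by decide +kernel
  rw [hΔ] at hqd ⊢
  have hqd' : q ∣ (-16811 : ℤ).natAbs := Int.natCast_dvd.mp hqd
  have hn : ((-16811 : ℤ).natAbs) = 16811 ^ 1 := by norm_num
  rw [hn] at hqd'
  obtain rfl := (Nat.prime_dvd_prime_iff_eq hqP (by norm_num)).mp (hqP.dvd_of_dvd_pow hqd')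
  exact ⟨1, by decide +kernel, by decide +kernel, Nat.not_dvd_of_pos_of_lt (by norm_num) (by omega)⟩

/-- **THE CRUX `KolyvaginDepthSupplyKN` AT THE RANK-THREE CURVE `16811a1` — INTRINSIC ROW IN `L`-VALUE CURRENCY, UNIFORM IN THE HEEGNER FIELD AND
IN THE PRIME (depth table v16).** For EVERY admissible `5 ≤ p < 1000` (good ordinary, `ρ_{E,p^n}` onto — hypotheses; Kodaira–Néron and ♠ hold
at every `p ≥ 5`), EVERY imaginary quadratic `K` with `d_K ∉ {−3,−4}`, `p ∤ d_K` and the Heegner hypothesis for `N = 16811`, and ANY globally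
minimal model `T` of the twist `E^{(d_K)}` (no arithmetic hypothesis on `T`: its irreducibility, good ordinary reduction and Skinner's (ram)
— at the multiplicative prime `16811` of `E`, which splits in `K` — are derived): IF `L(E^{(d_K)}, 1) ≠ 0` and `ord_p(L(T,1)/Ω_T) ≤ 3`, THEN the
clause of `KolyvaginDepthSupplyKN` holds at `W = 16811a1` VERBATIM (generic `cruxBody_of_twistLValue_intrinsic_spade`, tolerance `k = 3 ≤ rank`).
CONDITIONAL on Stein–Wuthrich Thm. 1.1, W. Zhang L8.4 (1) / 9.1, Skinner 2016 Thm. C, GZK by name; per curve; nothing class-wide; BSD is not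
proved by it. [cite: SteinWuthrich2013, Thm. 1.1 (p. 1758)] [cite: WZhang2014, Lemma 8.4 (1) (p. 236), Thm. 9.1 (p. 240)]
[cite: Skinner2016PacificMC, Thm. C (p. 173)] [cite: CremonaAlgorithms1997, Table 1 (16811a1)] -/
theorem cruxBody_LValue_intrinsic_at
    (hSW : SteinWuthrich2013_sha_inf_torsionBy_eq_bot_of_two_le_rank)
    (h84 : Literature.NumberTheory.EllipticCurves.WZhang2014_lemma84_exists_minimal_kolyvaginClass_one_selmerCard)
    (hSk : Skinner2016_padicValRat_bsd_rank_zero) (hGZK : rank_eq_analyticRank_of_analyticRank_le_one)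
    (p : ℕ) [hp : Fact p.Prime] (h5 : 5 ≤ p) (hp1000 : p < 1000)
    (hgood : haveI := isElliptic_of_mem_atlasR3A00 mem_atlas; haveI := isGloballyMinimal_of_mem_atlasR3A00 mem_atlas; (c16811a1.e.baseChange ℚ).HasGoodReductionAtPrime p)
    (hord : haveI := isElliptic_of_mem_atlasR3A00 mem_atlas; haveI := isGloballyMinimal_of_mem_atlasR3A00 mem_atlas; ¬ (p : ℤ) ∣ (c16811a1.e.baseChange ℚ).frobeniusTrace p)
    (htower : ∀ n : ℕ, (c16811a1.e.baseChange ℚ).HasSurjectiveModNGaloisRep (p ^ n : ℕ))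
    (K : Type) [Field K] [NumberField K] (hK : IsImaginaryQuadratic K)
    (hD3 : NumberField.discr K ≠ -3) (hD4 : NumberField.discr K ≠ -4) (hpD : ¬ ((p : ℤ) ∣ NumberField.discr K))
    (hH : SatisfiesHeegnerHypothesis 16811 K)
    (T : WeierstrassCurve ℚ) [T.IsElliptic] [T.IsGloballyMinimal] (C : WeierstrassCurve.VariableChange ℚ)
    (hC : C • T = (c16811a1.e.baseChange ℚ).quadraticTwist (NumberField.discr K : ℚ))
    (hL : ((c16811a1.e.baseChange ℚ).quadraticTwist (NumberField.discr K : ℚ)).entireLFunction 1 ≠ 0)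
    (hval : ∀ q : ℚ, T.entireLFunction 1 / ((T.realPeriodRat : ℝ) : ℂ) = (q : ℂ) → padicValRat p q ≤ 3) :
    haveI := isElliptic_of_mem_atlasR3A00 mem_atlas; haveI := isGloballyMinimal_of_mem_atlasR3A00 mem_atlas;
    ∃ (p : ℕ) (hp : Fact p.Prime), 5 ≤ p ∧ (c16811a1.e.baseChange ℚ).HasGoodReductionAtPrime p ∧
      ¬ (p : ℤ) ∣ (c16811a1.e.baseChange ℚ).frobeniusTrace p ∧ (∀ n : ℕ, (c16811a1.e.baseChange ℚ).HasSurjectiveModNGaloisRep (p ^ n : ℕ)) ∧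
      (∀ v : HeightOneSpectrum (𝓞 ℚ), (c16811a1.e.baseChange ℚ).HasMultiplicativeReductionAt v →
        ¬ p ∣ (c16811a1.e.baseChange ℚ).ordMinimalDiscriminant v) ∧
      ∃ (K : Type) (_ : Field K) (_ : NumberField K), IsImaginaryQuadratic K ∧
        NumberField.discr K ≠ -3 ∧ NumberField.discr K ≠ -4 ∧
        ∃ (_ : NeZero ((c16811a1.e.baseChange ℚ).conductorNorm ℤ)), SatisfiesHeegnerHypothesis ((c16811a1.e.baseChange ℚ).conductorNorm ℤ) K ∧
        ∃ (Dt : ModularParametrizationData (c16811a1.e.baseChange ℚ) ((c16811a1.e.baseChange ℚ).conductorNorm ℤ)) (β : ℤ) (ι : K →+* ℂ) (n₁ : ℕ)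
          (d : KolyvaginHeegnerData Dt β ι n₁), Squarefree n₁ ∧
          (∀ q ∈ n₁.primeFactors, Zhang2014.IsKolyvaginPrime ((c16811a1.e.baseChange ℚ).conductorNorm ℤ) (c16811a1.e.baseChange ℚ) K p q) ∧
          d.kolyvaginClass hp.out 1 ≠ 0 ∧
          (n₁.primeFactors.card + 1 ≤ (c16811a1.e.baseChange ℚ).mordellWeilRank ∨
            (n₁.primeFactors.card ≤ (c16811a1.e.baseChange ℚ).mordellWeilRank ∧
              n₁.primeFactors.card + 1 ≤ ((c16811a1.e.baseChange ℚ).quadraticTwist (NumberField.discr K : ℚ)).mordellWeilRank)) := by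
  haveI := isElliptic_of_mem_atlasR3A00 mem_atlas; haveI := isGloballyMinimal_of_mem_atlasR3A00 mem_atlas
  haveI iNZ : NeZero ((c16811a1.e.baseChange ℚ).conductorNorm ℤ) := neZero_conductorNorm_of_isElliptic _
  have hsp := spadeOne_of_five_le p h5
  have hHN : SatisfiesHeegnerHypothesis ((c16811a1.e.baseChange ℚ).conductorNorm ℤ) K := by rw [conductorNorm_eq]; exact hH
  have hS2 : ¬ Squarefree ((c16811a1.e.baseChange ℚ).conductorNorm ℤ) →
      (∃ (ℓ : ℕ) (_ : Fact ℓ.Prime), (c16811a1.e.baseChange ℚ).HasMultiplicativeReductionAtPrime ℓ ∧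
          ¬ p ∣ padicValInt ℓ (c16811a1.e.baseChange ℚ).minimalDiscriminantInt) ∧
        ∃ (ℓ₁ ℓ₂ : ℕ) (_ : Fact ℓ₁.Prime) (_ : Fact ℓ₂.Prime), ℓ₁ ≠ ℓ₂ ∧
          (c16811a1.e.baseChange ℚ).HasMultiplicativeReductionAtPrime ℓ₁ ∧ (c16811a1.e.baseChange ℚ).HasMultiplicativeReductionAtPrime ℓ₂ :=
    fun hns ↦ absurd ((c16811a1.e.baseChange ℚ).isSemistable_iff_squarefree_conductorNorm.mp hsp.2) hns
  have hmult : ∃ ℓ : ℕ, ∃ _ : Fact ℓ.Prime, (c16811a1.e.baseChange ℚ).HasMultiplicativeReductionAtPrime ℓ :=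
    ⟨16811, Fact.mk (by norm_num), by
      haveI := Fact.mk (by norm_num : Nat.Prime 16811)
      exact IntModel.hasMultiplicativeReductionAtPrime_of_intModel intModel 16811 (by decide +kernel) (by decide +kernel)⟩
  exact cruxBody_of_twistLValue_intrinsic_spade hSW h84 hSk hGZK _ not_hasCM (le_trans (by norm_num) three_le_rank)
    (by rw [conductorNorm_eq]; norm_num) hmult p h5 hp1000 hgood hord htower (kodairaNeron_of_five_le p h5) hsp.1 hS2 K hK hD3 hD4
    hpD hHN T C hC hL 3 three_le_rank hval

end C16811a1

namespace C18097b1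

/-- **Kodaira–Néron for `18097b1` at every `p ≥ 5`**: `|Δ_min| = 18097 = 18097`, every exponent `< 5`.
[cite: CremonaAlgorithms1997, Table 1 (18097b1)] [cite: SilvermanAEC2009, VII.5.1, VIII.8] -/
theorem kodairaNeron_of_five_le (p : ℕ) (h5 : 5 ≤ p) :
    haveI := isElliptic_of_mem_atlasR3A00 mem_atlas; haveI := isGloballyMinimal_of_mem_atlasR3A00 mem_atlas;
    ∀ v : HeightOneSpectrum (𝓞 ℚ), (c18097b1.e.baseChange ℚ).HasMultiplicativeReductionAt v →
      ¬ p ∣ (c18097b1.e.baseChange ℚ).ordMinimalDiscriminant v := by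
  haveI := isElliptic_of_mem_atlasR3A00 mem_atlas; haveI := isGloballyMinimal_of_mem_atlasR3A00 mem_atlas
  refine not_dvd_ordMinimalDiscriminant_of_intModel_table intModel (p := p) (Δ₀ := 18097) (by decide +kernel)
    (B := 8) (lt_of_lt_of_le (by norm_num) (Nat.pow_le_pow_right (by norm_num) h5)) ?_
  intro q hq hqP hqd
  have hn : ((18097 : ℤ).natAbs) = 18097 ^ 1 := by norm_num
  rw [hn] at hqd ⊢
  obtain rfl := (Nat.prime_dvd_prime_iff_eq hqP (by norm_num)).mp (hqP.dvd_of_dvd_pow hqd)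
  exact absurd (Finset.mem_range.mp hq) (by norm_num)

/-- **♠ (1) for `18097b1` at every prime `p ≥ 5`** (`|Δ_min| = 18097`, exponents `< 5`) **and semistability** (`gcd(c₄, Δ) = 1`).
[cite: WZhang2014, Hypothesis ♠ (pp. 194–195)] [cite: CremonaAlgorithms1997, Table 1 (18097b1)] -/
theorem spadeOne_of_five_le (p : ℕ) [hp : Fact p.Prime] (h5 : 5 ≤ p) :
    haveI := isElliptic_of_mem_atlasR3A00 mem_atlas; haveI := isGloballyMinimal_of_mem_atlasR3A00 mem_atlas;
    (∀ (ℓ : ℕ) [Fact ℓ.Prime], (c18097b1.e.baseChange ℚ).HasMultiplicativeReductionAtPrime ℓ →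
      ¬ p ∣ padicValInt ℓ (c18097b1.e.baseChange ℚ).minimalDiscriminantInt) ∧
      (c18097b1.e.baseChange ℚ).IsSemistable ℤ := by
  haveI := isElliptic_of_mem_atlasR3A00 mem_atlas; haveI := isGloballyMinimal_of_mem_atlasR3A00 mem_atlas
  refine ⟨not_dvd_padicValInt_of_intModel intModel p ?_,
    isSemistable_int_of_intModel_of_isCoprime intModel (by rw [Int.isCoprime_iff_gcd_eq_one]; decide +kernel)⟩
  intro q hqP hqd
  have hΔ : (⟨1, 1, 1, -10, 6⟩ : WeierstrassCurve ℤ).Δ = 18097 := by decide +kernel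
  rw [hΔ] at hqd ⊢
  have hqd' : q ∣ (18097 : ℤ).natAbs := Int.natCast_dvd.mp hqd
  have hn : ((18097 : ℤ).natAbs) = 18097 ^ 1 := by norm_num
  rw [hn] at hqd'
  obtain rfl := (Nat.prime_dvd_prime_iff_eq hqP (by norm_num)).mp (hqP.dvd_of_dvd_pow hqd')
  exact ⟨1, by decide +kernel, by decide +kernel, Nat.not_dvd_of_pos_of_lt (by norm_num) (by omega)⟩

/-- **THE CRUX `KolyvaginDepthSupplyKN` AT THE RANK-THREE CURVE `18097b1` — INTRINSIC ROW IN `L`-VALUE CURRENCY, UNIFORM IN THE HEEGNER FIELD AND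
IN THE PRIME (depth table v16).** For EVERY admissible `5 ≤ p < 1000` (good ordinary, `ρ_{E,p^n}` onto — hypotheses; Kodaira–Néron and ♠ hold
at every `p ≥ 5`), EVERY imaginary quadratic `K` with `d_K ∉ {−3,−4}`, `p ∤ d_K` and the Heegner hypothesis for `N = 18097`, and ANY globally
minimal model `T` of the twist `E^{(d_K)}` (no arithmetic hypothesis on `T`: its irreducibility, good ordinary reduction and Skinner's (ram)
— at the multiplicative prime `18097` of `E`, which splits in `K` — are derived): IF `L(E^{(d_K)}, 1) ≠ 0` and `ord_p(L(T,1)/Ω_T) ≤ 3`, THEN the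
clause of `KolyvaginDepthSupplyKN` holds at `W = 18097b1` VERBATIM (generic `cruxBody_of_twistLValue_intrinsic_spade`, tolerance `k = 3 ≤ rank`).
CONDITIONAL on Stein–Wuthrich Thm. 1.1, W. Zhang L8.4 (1) / 9.1, Skinner 2016 Thm. C, GZK by name; per curve; nothing class-wide; BSD is not
proved by it. [cite: SteinWuthrich2013, Thm. 1.1 (p. 1758)] [cite: WZhang2014, Lemma 8.4 (1) (p. 236), Thm. 9.1 (p. 240)]
[cite: Skinner2016PacificMC, Thm. C (p. 173)] [cite: CremonaAlgorithms1997, Table 1 (18097b1)] -/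
theorem cruxBody_LValue_intrinsic_at
    (hSW : SteinWuthrich2013_sha_inf_torsionBy_eq_bot_of_two_le_rank)
    (h84 : Literature.NumberTheory.EllipticCurves.WZhang2014_lemma84_exists_minimal_kolyvaginClass_one_selmerCard)
    (hSk : Skinner2016_padicValRat_bsd_rank_zero) (hGZK : rank_eq_analyticRank_of_analyticRank_le_one)
    (p : ℕ) [hp : Fact p.Prime] (h5 : 5 ≤ p) (hp1000 : p < 1000)
    (hgood : haveI := isElliptic_of_mem_atlasR3A00 mem_atlas; haveI := isGloballyMinimal_of_mem_atlasR3A00 mem_atlas; (c18097b1.e.baseChange ℚ).HasGoodReductionAtPrime p)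
    (hord : haveI := isElliptic_of_mem_atlasR3A00 mem_atlas; haveI := isGloballyMinimal_of_mem_atlasR3A00 mem_atlas; ¬ (p : ℤ) ∣ (c18097b1.e.baseChange ℚ).frobeniusTrace p)
    (htower : ∀ n : ℕ, (c18097b1.e.baseChange ℚ).HasSurjectiveModNGaloisRep (p ^ n : ℕ))
    (K : Type) [Field K] [NumberField K] (hK : IsImaginaryQuadratic K)
    (hD3 : NumberField.discr K ≠ -3) (hD4 : NumberField.discr K ≠ -4) (hpD : ¬ ((p : ℤ) ∣ NumberField.discr K))
    (hH : SatisfiesHeegnerHypothesis 18097 K)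
    (T : WeierstrassCurve ℚ) [T.IsElliptic] [T.IsGloballyMinimal] (C : WeierstrassCurve.VariableChange ℚ)
    (hC : C • T = (c18097b1.e.baseChange ℚ).quadraticTwist (NumberField.discr K : ℚ))
    (hL : ((c18097b1.e.baseChange ℚ).quadraticTwist (NumberField.discr K : ℚ)).entireLFunction 1 ≠ 0)
    (hval : ∀ q : ℚ, T.entireLFunction 1 / ((T.realPeriodRat : ℝ) : ℂ) = (q : ℂ) → padicValRat p q ≤ 3) :
    haveI := isElliptic_of_mem_atlasR3A00 mem_atlas; haveI := isGloballyMinimal_of_mem_atlasR3A00 mem_atlas;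
    ∃ (p : ℕ) (hp : Fact p.Prime), 5 ≤ p ∧ (c18097b1.e.baseChange ℚ).HasGoodReductionAtPrime p ∧
      ¬ (p : ℤ) ∣ (c18097b1.e.baseChange ℚ).frobeniusTrace p ∧ (∀ n : ℕ, (c18097b1.e.baseChange ℚ).HasSurjectiveModNGaloisRep (p ^ n : ℕ)) ∧
      (∀ v : HeightOneSpectrum (𝓞 ℚ), (c18097b1.e.baseChange ℚ).HasMultiplicativeReductionAt v →
        ¬ p ∣ (c18097b1.e.baseChange ℚ).ordMinimalDiscriminant v) ∧
      ∃ (K : Type) (_ : Field K) (_ : NumberField K), IsImaginaryQuadratic K ∧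
        NumberField.discr K ≠ -3 ∧ NumberField.discr K ≠ -4 ∧
        ∃ (_ : NeZero ((c18097b1.e.baseChange ℚ).conductorNorm ℤ)), SatisfiesHeegnerHypothesis ((c18097b1.e.baseChange ℚ).conductorNorm ℤ) K ∧
        ∃ (Dt : ModularParametrizationData (c18097b1.e.baseChange ℚ) ((c18097b1.e.baseChange ℚ).conductorNorm ℤ)) (β : ℤ) (ι : K →+* ℂ) (n₁ : ℕ)
          (d : KolyvaginHeegnerData Dt β ι n₁), Squarefree n₁ ∧
          (∀ q ∈ n₁.primeFactors, Zhang2014.IsKolyvaginPrime ((c18097b1.e.baseChange ℚ).conductorNorm ℤ) (c18097b1.e.baseChange ℚ) K p q) ∧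
          d.kolyvaginClass hp.out 1 ≠ 0 ∧
          (n₁.primeFactors.card + 1 ≤ (c18097b1.e.baseChange ℚ).mordellWeilRank ∨
            (n₁.primeFactors.card ≤ (c18097b1.e.baseChange ℚ).mordellWeilRank ∧
              n₁.primeFactors.card + 1 ≤ ((c18097b1.e.baseChange ℚ).quadraticTwist (NumberField.discr K : ℚ)).mordellWeilRank)) := by
  haveI := isElliptic_of_mem_atlasR3A00 mem_atlas; haveI := isGloballyMinimal_of_mem_atlasR3A00 mem_atlas
  haveI iNZ : NeZero ((c18097b1.e.baseChange ℚ).conductorNorm ℤ) := neZero_conductorNorm_of_isElliptic _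
  have hsp := spadeOne_of_five_le p h5
  have hHN : SatisfiesHeegnerHypothesis ((c18097b1.e.baseChange ℚ).conductorNorm ℤ) K := by rw [conductorNorm_eq]; exact hH
  have hS2 : ¬ Squarefree ((c18097b1.e.baseChange ℚ).conductorNorm ℤ) →
      (∃ (ℓ : ℕ) (_ : Fact ℓ.Prime), (c18097b1.e.baseChange ℚ).HasMultiplicativeReductionAtPrime ℓ ∧
          ¬ p ∣ padicValInt ℓ (c18097b1.e.baseChange ℚ).minimalDiscriminantInt) ∧
        ∃ (ℓ₁ ℓ₂ : ℕ) (_ : Fact ℓ₁.Prime) (_ : Fact ℓ₂.Prime), ℓ₁ ≠ ℓ₂ ∧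
          (c18097b1.e.baseChange ℚ).HasMultiplicativeReductionAtPrime ℓ₁ ∧ (c18097b1.e.baseChange ℚ).HasMultiplicativeReductionAtPrime ℓ₂ :=
    fun hns ↦ absurd ((c18097b1.e.baseChange ℚ).isSemistable_iff_squarefree_conductorNorm.mp hsp.2) hns
  have hmult : ∃ ℓ : ℕ, ∃ _ : Fact ℓ.Prime, (c18097b1.e.baseChange ℚ).HasMultiplicativeReductionAtPrime ℓ :=
    ⟨18097, Fact.mk (by norm_num), by
      haveI := Fact.mk (by norm_num : Nat.Prime 18097)
      exact IntModel.hasMultiplicativeReductionAtPrime_of_intModel intModel 18097 (by decide +kernel) (by decide +kernel)⟩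
  exact cruxBody_of_twistLValue_intrinsic_spade hSW h84 hSk hGZK _ not_hasCM (le_trans (by norm_num) three_le_rank)
    (by rw [conductorNorm_eq]; norm_num) hmult p h5 hp1000 hgood hord htower (kodairaNeron_of_five_le p h5) hsp.1 hS2 K hK hD3 hD4
    hpD hHN T C hC hL 3 three_le_rank hval

end C18097b1

end Summit.BirchSwinnertonDyer.BirchSwinnertonDyer.Theorems.KolyvaginDepthDoor

end
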